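import Mathlib
import Summits.Ventures.PercRepro2.Defs
import Summits.Ventures.PercRepro2.Independence
import Summits.Ventures.PercRepro2.Harris
import Summits.Ventures.PercRepro2.Graph
import Summits.Ventures.PercRepro2.Events
import Summits.Ventures.PercRepro2.Induced
import Summits.Ventures.PercRepro2.MixedBoxDefs
import Summits.Ventures.PercRepro2.BTVFamilyDefs
import Summits.Ventures.PercRepro2.BTVFamilyCorollary
import Summits.Ventures.PercRepro2.BlockConn
import Summits.Ventures.PercRepro2.BlockFamilyDefs
import Summits.Ventures.PercRepro2.BlockFamily
import Summits.Ventures.PercRepro2.BlockFamilyCorollary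

/-!
# The block family, mirrored: two `w`-vertices (blind cell PercRepro2, mine-1 g53;
paper proofs/MINE1-BLOCKS.md §2.5(c))

The mirror image of the block family (blocks on the `w`-side: several `w`'s, each in `C_t` in the
cells `a, m` and in neither cluster in `b, j`) is an INSTANCE of `bfamily` with the roots
exchanged — `bfamily p hp ends t s …` reads, in the original statuses, as a statement whose
`S`-blocks are `T`-blocks.  Its singleton case is `m(NSTT) m(STNN) ≤ m(SSNN) m(NTTT)` in the
coordinates `(u, v, w₁, w₂)` (`lsm_NSTT_STNN`, registry form `lsmPair4_NSTT_STNN`).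
-/

namespace Summit.Ventures.PercRepro2

namespace BlockFamily

open BTVFamily MixedBox

section Mirror

variable {V : Type*} {E : Type*} [Fintype E] [DecidableEq E] [Fintype V] [DecidableEq V]
  {R : Type*} [CommRing R] [LinearOrder R] [IsStrictOrderedRing R]

/-! ### The mirror: two `w`-vertices, by exchanging the roots -/

omit [DecidableEq E] in
/-- With the roots exchanged, the cell `b` with blocks `{{w₁}, {w₂}}` and `W = {u}` is `NSTT` in the
coordinates `(u, v, w₁, w₂)`. -/
lemma bEv_mirror_eq (ends : E → Sym2 V) (s t u v w₁ w₂ : V) :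
    bEv ends Finset.univ t s {v} {{w₁}, {w₂}} {u} = cell4 ends s t u v w₁ w₂ (1, 2, 0, 0) := by
  ext ω
  simp only [bEv, cell4, Set.mem_setOf_eq, Finset.coe_univ, induced_univ, bProp, unionB_pair,
    Finset.forall_mem_insert, Finset.mem_singleton, forall_eq,
    connSetB_singleton_singleton_of_singletons (singletons_pair w₁ w₂),
    connSet_union_right, connSet_pair_right, connSet_pair_left, connSet_singleton_singleton,
    status_eq_one_iff, status_eq_two_iff, status_eq_zero_iff, not_or]
  constructor
  · rintro ⟨⟨h1, h2⟩, h3, ⟨⟨h4, h5, h6⟩, h7⟩, h8, h9, h10⟩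
    exact ⟨⟨h7, h8⟩, conn_symm h3, ⟨h5, h1⟩, ⟨h6, h2⟩, h4⟩
  · rintro ⟨⟨h7, h8⟩, h3, ⟨h5, h1⟩, ⟨h6, h2⟩, h4⟩
    exact ⟨⟨h1, h2⟩, conn_symm h3, ⟨⟨h4, h5, h6⟩, h7⟩, h8,
      fun h => h8 (conn_trans h1 h), fun h => h8 (conn_trans h2 h)⟩

omit [DecidableEq E] in
/-- With the roots exchanged, the cell `a` with `A = {w₁, w₂}`, `W = {u}` is `STNN`. -/
lemma aEv_mirror_eq (ends : E → Sym2 V) (s t u v w₁ w₂ : V) :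
    aEv ends Finset.univ t s {v} {w₁, w₂} {u} = cell4 ends s t u v w₁ w₂ (2, 0, 1, 1) := by
  ext ω
  simp only [aEv, cell4, Set.mem_setOf_eq, Finset.coe_univ, induced_univ, aProp,
    connSet_union_right, connSet_pair_right, connSet_singleton_singleton,
    Finset.mem_singleton, forall_eq, status_eq_one_iff, status_eq_two_iff, status_eq_zero_iff,
    not_or]
  constructor
  · rintro ⟨h1, h2, ⟨⟨h3, h4, h5⟩, h6⟩, ⟨h7, h8⟩, h9, h10⟩
    exact ⟨h2, ⟨fun h => h3 (conn_trans (conn_symm h1) (conn_symm h)), conn_symm h1⟩, ⟨h7, h4⟩,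
      ⟨h8, h5⟩, fun h => h3 (conn_symm h)⟩
  · rintro ⟨h2, ⟨h1', h1⟩, ⟨h7, h4⟩, ⟨h8, h5⟩, h3⟩
    exact ⟨conn_symm h1, h2, ⟨⟨fun h => h3 (conn_symm h), h4, h5⟩,
      fun h => h3 (conn_trans h2 (conn_symm h))⟩, ⟨h7, h8⟩, fun h => h7 (conn_trans h2 h),
      fun h => h8 (conn_trans h2 h)⟩

omit [DecidableEq E] in
/-- With the roots exchanged, the cell `m` with `A = {w₁, w₂}`, `W = {u}` is `SSNN`. -/
lemma mEv_mirror_eq (ends : E → Sym2 V) (s t u v w₁ w₂ : V) :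
    mEv ends Finset.univ t s {v} {w₁, w₂} {u} = cell4 ends s t u v w₁ w₂ (2, 2, 1, 1) := by
  ext ω
  simp only [mEv, cell4, Set.mem_setOf_eq, Finset.coe_univ, induced_univ, mProp,
    connSet_union_right, connSet_union_left, connSet_pair_right,
    connSet_singleton_singleton, Finset.mem_singleton, forall_eq, status_eq_one_iff,
    status_eq_two_iff, not_or]
  constructor
  · rintro ⟨h1, h2, ⟨⟨h3, h4, h5⟩, h6⟩, ⟨h7, h8⟩, h9, h10⟩
    refine ⟨h1, ?_, ⟨h7, h4⟩, ⟨h9, h5⟩, fun h => h3 (conn_symm h)⟩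
    rcases h2 with h2 | h2
    · exact conn_symm h2
    · exact conn_trans h1 (conn_symm h2)
  · rintro ⟨h1, h2, ⟨h7, h4⟩, ⟨h9, h5⟩, h3⟩
    exact ⟨h1, Or.inl (conn_symm h2), ⟨⟨fun h => h3 (conn_symm h), h4, h5⟩,
      fun h => h3 (conn_trans h1 (conn_symm h))⟩, ⟨h7, fun h => h7 (conn_trans h1 h)⟩, h9,
      fun h => h9 (conn_trans h1 h)⟩

omit [DecidableEq E] in
/-- With the roots exchanged, the cell `j` with frontier `{w₁, w₂}`, blocks `{{w₁}, {w₂}}`,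
`W = {u}` is `NTTT`. -/
lemma jEv_mirror_eq (ends : E → Sym2 V) (s t u v w₁ w₂ : V) :
    jEv ends Finset.univ t s {v} {w₁, w₂} {{w₁}, {w₂}} {u} = cell4 ends s t u v w₁ w₂ (1, 0, 0, 0) := by
  ext ω
  simp only [jEv, cell4, Set.mem_setOf_eq, Finset.coe_univ, induced_univ, jProp,
    Finset.forall_mem_insert, Finset.mem_singleton, forall_eq,
    connSetB_singleton_singleton_of_singletons (singletons_pair w₁ w₂),
    connB_iff_conn_of_singletons (singletons_pair w₁ w₂),
    connSet_union_right, connSet_union_left, connSet_pair_right, connSet_pair_left,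
    connSet_singleton_singleton, status_eq_one_iff, status_eq_zero_iff, not_or]
  constructor
  · rintro ⟨⟨h1, h2⟩, h3, ⟨⟨h4, h5, h6⟩, h7⟩, h8, h9, h10⟩
    exact ⟨⟨h7, h8⟩, ⟨fun h => h4 (conn_trans h h3), conn_symm h3⟩, ⟨h5, h1⟩, ⟨h6, h2⟩, h4⟩
  · rintro ⟨⟨h7, h8⟩, ⟨h3', h3⟩, ⟨h5, h1⟩, ⟨h6, h2⟩, h4⟩
    exact ⟨⟨h1, h2⟩, conn_symm h3, ⟨⟨h4, h5, h6⟩, h7⟩, h8,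
      fun h => h8 (conn_trans h1 h), fun h => h8 (conn_trans h2 h)⟩

/-- **`m(NSTT) m(STNN) ≤ m(SSNN) m(NTTT)`** — the doubled (B-T) with two `w`-vertices, in the
coordinates `(u, v, w₁, w₂)`: the MIRROR of the block family, an instance of `bfamily` with the
roots exchanged (the `w`'s are the blocks of the root `t`). -/
theorem lsm_NSTT_STNN (p : E → R) (hp : IsProbVec p) (ends : E → Sym2 V) (s t u v w₁ w₂ : V) :
    prob p (cell4 ends s t u v w₁ w₂ (1, 2, 0, 0)) * prob p (cell4 ends s t u v w₁ w₂ (2, 0, 1, 1)) ≤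
      prob p (cell4 ends s t u v w₁ w₂ (2, 2, 1, 1)) *
        prob p (cell4 ends s t u v w₁ w₂ (1, 0, 0, 0)) := by
  have key := bfamily p hp ends t s {v} Finset.univ {w₁, w₂} {u} {{w₁}, {w₂}} {u}
    (Finset.subset_univ _) (Finset.subset_univ _) (Finset.subset_univ _) (Finset.subset_univ _)
  rw [unionB_pair, Finset.union_self, Finset.inter_self, Finset.union_self, Finset.inter_self,
    aEv_mirror_eq, bEv_mirror_eq, jEv_mirror_eq, mEv_mirror_eq, mul_comm] at key
  rw [mul_comm (prob p (cell4 ends s t u v w₁ w₂ (2, 2, 1, 1)))]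
  exact key

/-- `(NSTT, STNN)` in the registry form: `LSMPair4 (1,2,0,0) (2,0,1,1)`. -/
theorem lsmPair4_NSTT_STNN : LSMPair4 (1, 2, 0, 0) (2, 0, 1, 1) := by
  intro V E _ _ _ _ p hp ends s t x₁ x₂ x₃ x₄
  have hj : cellJoin4 (1, 2, 0, 0) (2, 0, 1, 1) = (2, 2, 1, 1) := by decide
  have hm : cellMeet4 (1, 2, 0, 0) (2, 0, 1, 1) = (1, 0, 0, 0) := by decide
  rw [hj, hm]
  exact lsm_NSTT_STNN p hp ends s t x₁ x₂ x₃ x₄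

end Mirror

end BlockFamily

end Summit.Ventures.PercRepro2
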